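import Literature.Computability.AlgebraicComplexity.ArithCircuitProjections
import Literature.Computability.AlgebraicComplexity.DepthThreeChasmCircuits
import Literature.Computability.AlgebraicComplexity.ValiantConjectureEquivProofs
import Literature.Computability.AlgebraicComplexity.ValiantCompleteness
import Literature.Computability.AlgebraicComplexity.StandardFamiliesProofs
import Literature.Computability.AlgebraicComplexity.IMMInVPProofs
import Literature.Computability.Complexity.ConstantDepthIMMProofs
import HarnessLib

/-!
# Route `DepthWindow` — the constant-depth rung: `per` is hard at every constant product-depth over `ℂ`

Helper file of the route `Theses/DepthWindow.lean` (decomp-valiant workshop, lens 4, generation 2; authored by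
the lens seat).  `perHardConstDepth Δ₀`: there is no `c` such that every `per_n` has an unbounded-fan-in circuit
over `ℂ` of product-depth `≤ Δ₀` with `≤ n^c + c` wires — i.e. the crux `PerHardLog3` (per hard at product-depth
`⌊log₂⌊log₂⌊log₂ n⌋⌋⌋ + 1`) with the growing depth replaced by a constant.  This is the BC5 witness (first rung)
of `PerHardLog3` IN THE PERMANENT FAMILY ITSELF; generation 0 had it as the plan-only stub
`stub_perHardConstDepth`.  Proof: the in-tree Limaye–Srinivasan–Tavenas theorem
`lst_constantDepth_imm_lower_bound_holds` (size `≥ m^{d^δ}` for product-depth-`Δ` circuits computing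
`IMM_{m,d}`, `d₀ ≤ d ≤ ε log m`) applied to the `VP` family `m ↦ IMM_{m, min m ⌊ε log m⌋}`, which is a
p-projection of the permanent by the in-tree `VNP`-completeness (`isVNPComplete_perPoly_holds`); a
p-projection is realised by a `substVC` circuit projection with the same product-depth and no more wires
(`exists_circuit_of_isProjection`, few-gates normal form `exists_size_le_edgeSize`), and `window_arith` supplies
an `m` with `m^b + b < m^{(min m ⌊ε log m⌋)^δ}`.  Unconditional, 0 sorry, closes no item (used by
`DepthWindowDial.lean`: `collapseToDepth_const_iff_vh`, the bottom bracket of the window).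

References: [LimayeSrinivasanTavenas2025] Thm 1 / Cor. 4; [Valiant1979] (VNP-completeness of per);
[Burgisser2000TCS] §2 (p-projections).
-/

-- layout Summits/ValiantsHypothesis/ValiantsHypothesis forces the duplicated namespace component
set_option linter.dupNamespace false

namespace Summit.ValiantsHypothesis.ValiantsHypothesis.Theorems.DepthWindow

open MvPolynomial Literature.Computability.AlgebraicComplexity ArithCircuit
open Literature.Computability.Complexity

noncomputable section

/-- A Valiant projection is realised by a `substVC` substitution datum. [cite: Burgisser2000TCS, §2] -/
theorem exists_substVCFun_of_isProjection {k : Type*} [CommSemiring k] {σ τ : Type*}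
    {g : MvPolynomial τ k} {f : MvPolynomial σ k} (h : IsProjection g f) :
    ∃ s : σ → τ ⊕ k, g = aeval (substVCFun s) f := by
  obtain ⟨a, ha, rfl⟩ := h
  have : ∀ i, ∃ u : τ ⊕ k, Sum.elim X C u = a i := fun i => by
    rcases ha i with ⟨j, hj⟩ | ⟨c, hc⟩
    · exact ⟨Sum.inl j, hj.symm⟩
    · exact ⟨Sum.inr c, hc.symm⟩
  choose s hs using this
  refine ⟨s, ?_⟩
  have hfun : substVCFun s = a := funext fun i => hs i
  rw [hfun]

/-- **Circuit transport along a projection** (same product-depth, no more wires, few gates): if `g` is a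
projection of `f` and `f` has a circuit of product-depth `≤ Δ` with `≤ e` wires, then `g` has a circuit of
product-depth `≤ Δ` with `≤ e` wires and `≤ e` gates. [cite: Burgisser2000TCS, §2] -/
theorem exists_circuit_of_isProjection {σ τ : Type*} {g : MvPolynomial τ ℂ} {f : MvPolynomial σ ℂ}
    (h : IsProjection g f) (C : ArithCircuit ℂ σ) (hC : C.Computes f) :
    ∃ D : ArithCircuit ℂ τ, D.Computes g ∧ D.productDepth ≤ C.productDepth ∧
      D.edgeSize ≤ C.edgeSize ∧ D.size ≤ C.edgeSize := by
  obtain ⟨s, hs⟩ := exists_substVCFun_of_isProjection h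
  obtain ⟨D, hDe, hDd, hDw, hDs⟩ := exists_size_le_edgeSize (C.substVC s)
  refine ⟨D, ?_, ?_, ?_, hDs.trans ?_⟩
  · rw [Computes, hDe, eval_substVC, hs]
    rw [Computes] at hC
    rw [hC]
  · rw [productDepth_substVC] at hDd; exact hDd
  · rw [edgeSize_substVC] at hDw; exact hDw
  · rw [edgeSize_substVC] at hDw; exact hDw

/-- **The arithmetic of the window's bottom**: for every exponent `b`, threshold `d₀` and `δ, ε > 0` there is
`m ≥ 2` with `d₀ ≤ D := min m ⌊ε log m⌋` and `m^b + b < m^{D^δ}` (namely any `m ≥ e^{(M+1)/ε}`,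
`M = max d₀ ⌈(b+1)^{1/δ}⌉`). [folklore] -/
theorem window_arith (b d₀ : ℕ) {δ ε : ℝ} (hδ : 0 < δ) (hε : 0 < ε) :
    ∃ m : ℕ, 2 ≤ m ∧ d₀ ≤ min m ⌊ε * Real.log m⌋₊ ∧
      ((m ^ b + b : ℕ) : ℝ) < (m : ℝ) ^ (((min m ⌊ε * Real.log m⌋₊ : ℕ) : ℝ) ^ δ) := by
  set K : ℕ := ⌈((b : ℝ) + 1) ^ δ⁻¹⌉₊ with hK
  set M : ℕ := max d₀ K with hM
  set m : ℕ := max (max M 2) ⌈Real.exp (((M : ℝ) + 1) / ε)⌉₊ with hm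
  have hm2 : 2 ≤ m := le_max_of_le_left (le_max_right _ _)
  have hmM : M ≤ m := le_max_of_le_left (le_max_left _ _)
  have hceil : ⌈Real.exp (((M : ℝ) + 1) / ε)⌉₊ ≤ m := le_max_right _ _
  have hmexp : Real.exp (((M : ℝ) + 1) / ε) ≤ (m : ℝ) :=
    (Nat.le_ceil _).trans (Nat.cast_le.2 hceil)
  have hmpos : (0 : ℝ) < m := by exact_mod_cast (show 0 < m by omega)
  have hlog : ((M : ℝ) + 1) / ε ≤ Real.log m := (Real.le_log_iff_exp_le hmpos).2 hmexp
  have hεlog : (M : ℝ) + 1 ≤ ε * Real.log m := by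
    have := mul_le_mul_of_nonneg_left hlog hε.le
    rwa [mul_div_cancel₀ _ hε.ne'] at this
  have hfloor : M + 1 ≤ ⌊ε * Real.log m⌋₊ := Nat.le_floor (by push_cast; exact hεlog)
  set D : ℕ := min m ⌊ε * Real.log m⌋₊ with hD
  have hDM : M ≤ D := le_min hmM (by omega)
  refine ⟨m, hm2, (le_max_left _ _).trans hDM, ?_⟩
  -- exponent comparison: (b+1 : ℝ) ≤ D^δ
  have hKD : K ≤ D := (le_max_right _ _).trans hDM
  have hb1 : (0 : ℝ) ≤ (b : ℝ) + 1 := by positivity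
  have hexp : (b : ℝ) + 1 ≤ (D : ℝ) ^ δ := by
    calc (b : ℝ) + 1 = (((b : ℝ) + 1) ^ δ⁻¹) ^ δ := (Real.rpow_inv_rpow hb1 hδ.ne').symm
      _ ≤ (K : ℝ) ^ δ := Real.rpow_le_rpow (Real.rpow_nonneg hb1 _) (Nat.le_ceil _) hδ.le
      _ ≤ (D : ℝ) ^ δ := Real.rpow_le_rpow (Nat.cast_nonneg K) (by exact_mod_cast hKD) hδ.le
  have hm1 : (1 : ℝ) ≤ m := by exact_mod_cast (show 1 ≤ m by omega)
  -- natural-number comparison: m^b + b < m^(b+1)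
  have hnat : m ^ b + b < m ^ (b + 1) := by
    have h2b : b < 2 ^ b := Nat.lt_two_pow_self
    have hpow : 2 ^ b ≤ m ^ b := Nat.pow_le_pow_left hm2 b
    have : m ^ (b + 1) = m ^ b * m := pow_succ _ _
    nlinarith
  calc ((m ^ b + b : ℕ) : ℝ) < ((m ^ (b + 1) : ℕ) : ℝ) := by exact_mod_cast hnat
    _ = (m : ℝ) ^ ((b : ℝ) + 1) := by
        rw [show ((b : ℝ) + 1) = ((b + 1 : ℕ) : ℝ) by push_cast; ring, Real.rpow_natCast]
        push_cast; ring
    _ ≤ (m : ℝ) ^ ((D : ℝ) ^ δ) := Real.rpow_le_rpow_of_exponent_le hm1 hexp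

/-- **The constant-depth rung, PROVED**: for every constant `Δ₀`, the permanent has no polynomial-wire
circuits of product-depth `≤ Δ₀` over `ℂ` (`A_{Δ₀}`).  Limaye–Srinivasan–Tavenas (tree:
`lst_constantDepth_imm_lower_bound_holds`) for the `VP` family `m ↦ IMM_{m, min m ⌊ε log m⌋}` transported to the
`VNP`-complete permanent (`isVNPComplete_perPoly_holds`) along a p-projection (`exists_circuit_of_isProjection`).
[cite: LimayeSrinivasanTavenas2025, Cor. 4] [cite: Valiant1979] -/
theorem perHardConstDepth (Δ₀ : ℕ) :
    ¬ ∃ c : ℕ, ∀ n : ℕ, ∃ C : ArithCircuit ℂ (Fin n × Fin n),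
      C.Computes (perPoly (Fin n) ℂ) ∧ C.productDepth ≤ Δ₀ ∧ C.edgeSize ≤ n ^ c + c := by
  classical
  suffices hmain : ∀ Δ, 1 ≤ Δ → ¬ ∃ c : ℕ, ∀ n : ℕ, ∃ C : ArithCircuit ℂ (Fin n × Fin n),
      C.Computes (perPoly (Fin n) ℂ) ∧ C.productDepth ≤ Δ ∧ C.edgeSize ≤ n ^ c + c by
    rcases Nat.eq_zero_or_pos Δ₀ with rfl | hpos
    · rintro ⟨c, hc⟩
      refine hmain 1 le_rfl ⟨c, fun n => ?_⟩
      obtain ⟨C, h1, h2, h3⟩ := hc n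
      exact ⟨C, h1, h2.trans (Nat.zero_le 1), h3⟩
    · exact hmain Δ₀ hpos
  intro Δ hΔ
  rintro ⟨c, hc⟩
  obtain ⟨δ, hδ, ε, hε, d₀, hL⟩ := lst_constantDepth_imm_lower_bound_holds ℂ Δ hΔ
  -- the degree function
  let dd : ℕ → ℕ := fun m => min m ⌊ε * Real.log m⌋₊
  have hdd_le : ∀ m, dd m ≤ m := fun m => min_le_left _ _
  have hdd_log : ∀ m, (dd m : ℝ) ≤ ε * Real.log m := fun m => by
    have h0 : 0 ≤ ε * Real.log m := mul_nonneg hε.le (Real.log_natCast_nonneg m)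
    exact (Nat.cast_le.2 (min_le_right _ _)).trans (Nat.floor_le h0)
  -- the IMM family and its renaming to `Fin (v m)` variables
  let v : ℕ → ℕ := fun m => Fintype.card (Fin (dd m) × Fin m × Fin m)
  let e : ∀ m, (Fin (dd m) × Fin m × Fin m) ≃ Fin (v m) := fun m => Fintype.equivFin _
  let G : ∀ m, MvPolynomial (Fin (dd m) × Fin m × Fin m) ℂ := fun m => immPoly m (dd m) ℂ
  let G' : ∀ m, MvPolynomial (Fin (v m)) ℂ := fun m => renameEquiv ℂ (e m) (G m)
  have hG : IsVPFamily G := by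
    refine ⟨⟨⟨3, fun m => ?_⟩, ⟨1, fun m => ?_⟩⟩, ⟨6, fun m => ?_⟩⟩
    · show Fintype.card (Fin (dd m) × Fin m × Fin m) ≤ m ^ 3 + 3
      simp only [Fintype.card_prod, Fintype.card_fin]
      calc dd m * (m * m) ≤ m * (m * m) := Nat.mul_le_mul_right _ (hdd_le m)
        _ = m ^ 3 := by ring
        _ ≤ m ^ 3 + 3 := Nat.le_add_right _ _
    · show (immPoly m (dd m) ℂ).totalDegree ≤ m ^ 1 + 1
      refine ((immPoly_isHomogeneous_holds (k := ℂ) m (dd m)).totalDegree_le).trans ?_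
      rw [pow_one]; exact (hdd_le m).trans (Nat.le_succ m)
    · show complexity (immPoly m (dd m) ℂ) ≤ m ^ 6 + 6
      calc complexity (immPoly m (dd m) ℂ) ≤ m + 2 * m ^ 3 * dd m := complexity_immPoly_le ℂ m (dd m)
        _ ≤ m ^ 1 + 2 * (m ^ 1) ^ 3 * m := by
            rw [pow_one]; exact Nat.add_le_add_left (Nat.mul_le_mul_left _ (hdd_le m)) _
        _ ≤ m ^ (3 * 1 + 3) + (3 * 1 + 3) := imm_cost_le 1 m
        _ = m ^ 6 + 6 := by norm_num
  have hG' : IsVPFamily G' := (isVPFamily_renameEquiv_iff e G).2 hG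
  have hG'N : IsVNPFamily G' := IsVPFamily.isVNPFamily_holds' hG'
  -- VNP-completeness of the permanent over ℂ: `G'` is a p-projection of `per`
  obtain ⟨t, ht, hproj⟩ := (isVNPComplete_perPoly_holds ℂ ringChar_complex_ne_two).2 v G' hG'N
  obtain ⟨b, hb⟩ : IsPBounded fun m => t m ^ c + c :=
    IsPBounded.comp_holds (s := fun N => N ^ c + c) ⟨c, fun N => le_rfl⟩ ht
  -- depth-Δ circuits with few gates for `G m = IMM_{m, dd m}`
  have key : ∀ m, ∃ D : ArithCircuit ℂ (Fin (dd m) × Fin m × Fin m),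
      D.Computes (G m) ∧ D.productDepth ≤ Δ ∧ D.size ≤ m ^ b + b := by
    intro m
    obtain ⟨C, hCc, hCd, hCe⟩ := hc (t m)
    obtain ⟨D', hD'c, hD'd, hD'e, -⟩ := exists_circuit_of_isProjection (hproj m) C hCc
    -- rename back from `Fin (v m)` to the IMM variables
    have hGm : MvPolynomial.rename (e m).symm (G' m) = G m := by
      show MvPolynomial.rename (e m).symm (renameEquiv ℂ (e m) (G m)) = G m
      rw [renameEquiv_apply, rename_rename, (e m).symm_comp_self, rename_id_apply]
    obtain ⟨D, hDe, hDd, hDw, hDs⟩ := exists_size_le_edgeSize (D'.rename (e m).symm)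
    refine ⟨D, ?_, ?_, ?_⟩
    · rw [Computes, hDe, ← hGm]; exact hD'c.rename (e m).symm
    · exact hDd.trans ((DepthThreeChasm.productDepth_rename _ _).le.trans (hD'd.trans hCd))
    · calc D.size ≤ D.edgeSize := hDs
        _ ≤ (D'.rename (e m).symm).edgeSize := hDw
        _ = D'.edgeSize := DepthThreeChasm.edgeSize_rename _ _
        _ ≤ C.edgeSize := hD'e
        _ ≤ t m ^ c + c := hCe
        _ ≤ m ^ b + b := hb m
  -- the contradiction at a large `m`
  obtain ⟨m, -, hd₀, hlt⟩ := window_arith b d₀ hδ hε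
  obtain ⟨D, hDc, hDd, hDs⟩ := key m
  have hlow : (m : ℝ) ^ (((dd m : ℕ) : ℝ) ^ δ) ≤ (D.size : ℝ) := hL m (dd m) hd₀ (hdd_log m) D hDd hDc
  have hup : (D.size : ℝ) ≤ ((m ^ b + b : ℕ) : ℝ) := by exact_mod_cast hDs
  exact absurd (hlow.trans hup) (not_le.2 hlt)


/-- **Registered-stub form** (crux `PerHardLog3`, stub `perHardConstDepth_lst`; the exact body of the generation-0
plan-only BC5 stub `Sig.stub_perHardConstDepth` of the registered skeleton `line-imm-transfer`): for every constant
`Δ₀` and exponent `c` some `per_n` has NO product-depth-`Δ₀` circuit with `≤ n^c + c` wires.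
[cite: LimayeSrinivasanTavenas2025, Cor. 4] -/
theorem perHardConstDepth_lst : ∀ Δ₀ c : ℕ, ∃ n : ℕ, ∀ C : ArithCircuit ℂ (Fin n × Fin n), C.Computes (perPoly (Fin n) ℂ) → C.productDepth ≤ Δ₀ → n ^ c + c < C.edgeSize := by
  intro Δ₀ c
  by_contra h
  refine perHardConstDepth Δ₀ ⟨c, fun n => ?_⟩
  by_contra hn
  exact h ⟨n, fun C hC hd => not_le.mp fun hle => hn ⟨C, hC, hd, hle⟩⟩

end

end Summit.ValiantsHypothesis.ValiantsHypothesis.Theorems.DepthWindow
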